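import Summits.CriticalPhenomena.PercolationContinuityZ3.Theorems.PercNearOneGluingNoHeavyLowerTailFKHullPortTAInduction
import Summits.CriticalPhenomena.PercolationContinuityZ3.Theorems.PercNearOneGluingNoHeavyLowerTailFKCovTransferRelaySet
import Literature.Probability.Percolation.TwoClusterGibbsCovarianceRC
import Literature.Probability.LatticeModels.RandomClusterEdgeWeightsContinuity
import HarnessLib

/-!
# FK sub-lane: MDL(X) for the random-cluster measure `φ_{𝐩,q}` (`q ≥ 1`) from the averaged inequality `T_A ≥ 0`

Support file (`--supports stmt-CriticalPhenomena-4575`); builds on p205010 (kernel theorem, internal audit signed; external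
expert review pending).  No definitions, no named facts, no sorries; standard axioms.  Written by the literature seat
prim-cplus-literature (gen 48) at the suggestion of prim-postcont-3 (gen 10) for the FK sub-lane (bschramm/FK-Q2.md §12.6(b),
§12.7 L-f); to be landed by a prover seat (Theorems/ is prover-only).

This is the random-cluster twin of `HullPort.markerDominanceAvoid_of_TA` / `HullPort.TA_integral_eq_taQ` /
`HullPort.markerDominanceAvoid_of_Pv` (`…HullPortSelectionThreeTA.lean`, `…HullPortTAInduction.lean`, product measure):
the functional MARKER DOMINANCE LEMMA WITH AN AVOIDED SET `X` (MDL(X)) for `φ = rcMeasureW w q ∅`, every `q ≥ 1` and every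
parameter vector `w`,
  `φ(A ∩ W)·[φ(D)∫_{D∩Y} F − (∫_D F) φ(D∩Y)] ≤ φ(A)·[φ(D)∫_{D∩Z} F − (∫_D F) φ(D∩Z)]`
(`D = {s ↮ X}`, `A = {y ↮ s, X}`, `W = {y ↔ z}`, `Y = {s ↔ y}`, `Z = {s ↔ z}`, `F` monotone in the edge cluster `C_s`), from the
averaged inequality `T_A ≥ 0` at all non-degenerate parameters — in measure form (`FK.markerDominanceAvoid_of_TA_rc`), in the
sum form `0 ≤ FK.taQ` of `…FKHullPortTADefs.lean` (`FK.markerDominanceAvoid_of_taQ`, through the dictionary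
`FK.TA_integral_eq_taQ_rc`: measure form `= FK.taQ / Z²`), and from prim-hp-7's Lemma `P_v` for `φ_{𝐩,q}` in the exact shape
of the hypothesis `hPv` of `FK.taQ_nonneg_of_Pv` (`FK.markerDominanceAvoid_of_Pv_rc`).  With fk-2's `FK.taQ_nonneg_of_Pv` this
closes FK-Q2 §12.6(b) in Lean modulo `P_v` for `φ_{𝐩,q}` only.
Proof = prove-5's `q = 1` proof with the three substitutions named in FK-Q2 §12.6(b): the worlds are the random-cluster
measures `rcMeasureW (delW p A_X(ω)) q ∅` (pairs meeting the open cluster of `X` deleted, same `q`; vdBHK Lemma 2.3), the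
world marker dominance lemma MDL(∅) is `FK.covTransfer_relaySet_edge_rc` at `S = {s}` (vdBHK Thm 2.1 negative correlation +
FKG), Harris in the world is FKG (`FK.setIntegral_edgeFun_ge_rc`), and the Gibbs-sampler reduction is the tree's
`BHK2006_twoMarkerCov_le_of_within_rc_of_forall_nondegenerate` (`TwoClusterGibbsCovarianceRC.lean`; continuity of
`𝐩 ↦ φ_{𝐩,q}(E)` = `rcMeasureW_real_continuous`).
[cite: VandenbergHaggstromKahn2005, Thm. 2.1 (p. 9), §2.1 Lemmas 2.3–2.4 (p. 10), pp. 10–13 — corollaries, derived in the cell]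
[cite: Grimmett2006, Thm. (3.8)(b); §1.4 eq. (1.20) (p. 15); §4.5 (continuity in `p`)]
-/

noncomputable section

namespace Summit.CriticalPhenomena.PercolationContinuityZ3.Theorems.FK

open MeasureTheory Set Literature.Probability.LatticeModels Literature.Probability.Percolation
open Literature.Probability.Percolation.DecisionTree (ind ind_of_mem ind_of_not_mem ind_nonneg)
open Literature.Probability.Percolation.BHK2006 (rcMass delW rcMass_nonneg integral_rcMeasureW_eq_sum
  setIntegral_rcMeasureW_eq_sum rcMeasureW_real_eq_sum_rcMass)
open Literature.Probability.Percolation.KNPreFKG (openConn_symm)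
open Summit.CriticalPhenomena.PercolationContinuityZ3.Theorems.HullPort (cut avoidEv)
open scoped Classical

variable {V : Type*} [Fintype V]

/-- **MDL(X) for `φ_{𝐩,q}`, `q ≥ 1`, from `T_A ≥ 0` (measure form).**  For `s ≠ y`, a marker `z`, an avoided set `X`,
`D = {s ↮ X}`, `A = {y ↮ s, X}` (as `{ω | ∀ x ∈ insert s X, y ↮ x}`), `W = {y ↔ z}`, `Y = {s ↔ y}`, `Z = {s ↔ z}`,
`φ_𝐩 = rcMeasureW 𝐩 q ∅` and the worlds `φ^ω_𝐩 = rcMeasureW (delW 𝐩 A_X(ω)) q ∅` (pairs meeting the open vertex cluster of `X`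
in `ω` deleted, same `q`): if for all non-degenerate `𝐩` and all monotone `g ≥ 0`
`0 ≤ ∫_D ( φ_𝐩(A)·φ^ω(Yᶜ ∩ W)/φ^ω(Yᶜ) − φ_𝐩(A ∩ W) )·( ∫_Y g(C_s) dφ^ω − (∫ g(C_s) dφ^ω) φ^ω(Y) ) dφ_𝐩(ω)`
(hypothesis `hTA`, `x/0 := 0`; the averaged inequality `T_A ≥ 0` of prim-hp-7 for `φ_{𝐩,q}`), then for every `w` and every
monotone `F` of the edge cluster `C_s`,
`φ_w(A ∩ W)·[φ_w(D)∫_{D∩Y} F − (∫_D F) φ_w(D∩Y)] ≤ φ_w(A)·[φ_w(D)∫_{D∩Z} F − (∫_D F) φ_w(D∩Z)]`.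
The `q = 1` statement is `HullPort.markerDominanceAvoid_of_TA`.
[cite: VandenbergHaggstromKahn2005, Thm. 2.1 (p. 9), §2.1 pp. 10–13 — corollary, derived in the cell] [cite: Grimmett2006, Thm. (3.8)(b); §4.5] -/
theorem markerDominanceAvoid_of_TA_rc {q : ℝ} (hq : 1 ≤ q) (w : Sym2 V → unitInterval) (s y z : V) (X : Set V)
    (hTA : ∀ p : Sym2 V → unitInterval, (∀ e, 0 < p e ∧ p e < 1) →
      ∀ g : Set (Sym2 V) → ℝ, Monotone g → (∀ C, 0 ≤ g C) →
      0 ≤ ∫ ω in {ω : BondConfig V | ∀ x ∈ X, ¬ (openGraph ω).Reachable s x},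
        ((rcMeasureW p q ∅).real {ω' : BondConfig V | ∀ x ∈ insert s X, ¬ (openGraph ω').Reachable y x} *
              ((rcMeasureW (delW p {e | ∃ v ∈ e, ∃ x ∈ X, (openGraph ω).Reachable x v}) q ∅).real
                  ((openConn s y : Set (BondConfig V))ᶜ ∩ openConn y z) /
                (rcMeasureW (delW p {e | ∃ v ∈ e, ∃ x ∈ X, (openGraph ω).Reachable x v}) q ∅).real
                  (openConn s y : Set (BondConfig V))ᶜ) -
            (rcMeasureW p q ∅).real ({ω' : BondConfig V | ∀ x ∈ insert s X, ¬ (openGraph ω').Reachable y x} ∩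
              openConn y z)) *
          ((∫ η in (openConn s y : Set (BondConfig V)), g (openEdgeCluster η s)
                ∂(rcMeasureW (delW p {e | ∃ v ∈ e, ∃ x ∈ X, (openGraph ω).Reachable x v}) q ∅)) -
            (∫ η, g (openEdgeCluster η s)
                ∂(rcMeasureW (delW p {e | ∃ v ∈ e, ∃ x ∈ X, (openGraph ω).Reachable x v}) q ∅)) *
              (rcMeasureW (delW p {e | ∃ v ∈ e, ∃ x ∈ X, (openGraph ω).Reachable x v}) q ∅).real
                (openConn s y : Set (BondConfig V)))
        ∂(rcMeasureW p q ∅))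
    (F : Set (Sym2 V) → ℝ) (hF : Monotone F) :
    (rcMeasureW w q ∅).real ({ω : BondConfig V | ∀ x ∈ insert s X, ¬ (openGraph ω).Reachable y x} ∩ openConn y z) *
        ((rcMeasureW w q ∅).real {ω : BondConfig V | ∀ x ∈ X, ¬ (openGraph ω).Reachable s x} *
            (∫ ω in {ω : BondConfig V | ∀ x ∈ X, ¬ (openGraph ω).Reachable s x} ∩ openConn s y,
              F (openEdgeCluster ω s) ∂(rcMeasureW w q ∅)) -
          (∫ ω in {ω : BondConfig V | ∀ x ∈ X, ¬ (openGraph ω).Reachable s x},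
              F (openEdgeCluster ω s) ∂(rcMeasureW w q ∅)) *
            (rcMeasureW w q ∅).real ({ω : BondConfig V | ∀ x ∈ X, ¬ (openGraph ω).Reachable s x} ∩ openConn s y)) ≤
      (rcMeasureW w q ∅).real {ω : BondConfig V | ∀ x ∈ insert s X, ¬ (openGraph ω).Reachable y x} *
        ((rcMeasureW w q ∅).real {ω : BondConfig V | ∀ x ∈ X, ¬ (openGraph ω).Reachable s x} *
            (∫ ω in {ω : BondConfig V | ∀ x ∈ X, ¬ (openGraph ω).Reachable s x} ∩ openConn s z,
              F (openEdgeCluster ω s) ∂(rcMeasureW w q ∅)) -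
          (∫ ω in {ω : BondConfig V | ∀ x ∈ X, ¬ (openGraph ω).Reachable s x},
              F (openEdgeCluster ω s) ∂(rcMeasureW w q ∅)) *
            (rcMeasureW w q ∅).real ({ω : BondConfig V | ∀ x ∈ X, ¬ (openGraph ω).Reachable s x} ∩ openConn s z)) := by
  classical
  have hq0 : 0 < q := one_pos.trans_le hq
  -- the coefficients `a_𝐩 = φ_𝐩(A)`, `b_𝐩 = φ_𝐩(A ∩ W)`, continuous in the parameters
  have ha : Continuous fun p : Sym2 V → unitInterval =>
      (rcMeasureW p q ∅).real {ω' : BondConfig V | ∀ x ∈ insert s X, ¬ (openGraph ω').Reachable y x} :=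
    rcMeasureW_real_continuous hq0 ∅ _
  have hb : Continuous fun p : Sym2 V → unitInterval =>
      (rcMeasureW p q ∅).real ({ω' : BondConfig V | ∀ x ∈ insert s X, ¬ (openGraph ω').Reachable y x} ∩
        openConn y z) :=
    rcMeasureW_real_continuous hq0 ∅ _
  -- the hypothesis of the reduction theorem, from `hTA`, the world MDL(∅) (`FK.covTransfer_relaySet_edge_rc`) and FKG
  have hR : ∀ p : Sym2 V → unitInterval, (∀ e, 0 < p e ∧ p e < 1) →
      ∀ g : Set (Sym2 V) → ℝ, Monotone g → (∀ C, 0 ≤ g C) →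
      0 ≤ ∫ ω in {ω : BondConfig V | ∀ x ∈ X, ¬ (openGraph ω).Reachable s x},
        ((rcMeasureW p q ∅).real {ω' : BondConfig V | ∀ x ∈ insert s X, ¬ (openGraph ω').Reachable y x} *
            ((∫ η in (openConn s z : Set (BondConfig V)), g (openEdgeCluster η s)
                ∂(rcMeasureW (delW p {e | ∃ v ∈ e, ∃ x ∈ X, (openGraph ω).Reachable x v}) q ∅)) -
              (∫ η, g (openEdgeCluster η s)
                ∂(rcMeasureW (delW p {e | ∃ v ∈ e, ∃ x ∈ X, (openGraph ω).Reachable x v}) q ∅)) *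
              (rcMeasureW (delW p {e | ∃ v ∈ e, ∃ x ∈ X, (openGraph ω).Reachable x v}) q ∅).real
                (openConn s z : Set (BondConfig V))) -
          (rcMeasureW p q ∅).real ({ω' : BondConfig V | ∀ x ∈ insert s X, ¬ (openGraph ω').Reachable y x} ∩
              openConn y z) *
            ((∫ η in (openConn s y : Set (BondConfig V)), g (openEdgeCluster η s)
                ∂(rcMeasureW (delW p {e | ∃ v ∈ e, ∃ x ∈ X, (openGraph ω).Reachable x v}) q ∅)) -
              (∫ η, g (openEdgeCluster η s)
                ∂(rcMeasureW (delW p {e | ∃ v ∈ e, ∃ x ∈ X, (openGraph ω).Reachable x v}) q ∅)) *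
              (rcMeasureW (delW p {e | ∃ v ∈ e, ∃ x ∈ X, (openGraph ω).Reachable x v}) q ∅).real
                (openConn s y : Set (BondConfig V))))
        ∂(rcMeasureW p q ∅) := by
    intro p hp g hg hg0
    haveI : IsProbabilityMeasure (rcMeasureW p q ∅) := isProbabilityMeasure_rcMeasureW p hq0 ∅
    refine le_trans (hTA p hp g hg hg0) (setIntegral_mono_on (Integrable.of_finite).integrableOn
      (Integrable.of_finite).integrableOn MeasurableSet.of_discrete ?_)
    intro ω _
    -- fix the configuration `ω`; the world `ν = φ_{G − C̄_X(ω), q}`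
    haveI : IsProbabilityMeasure
        (rcMeasureW (delW p {e | ∃ v ∈ e, ∃ x ∈ X, (openGraph ω).Reachable x v}) q ∅) :=
      isProbabilityMeasure_rcMeasureW _ hq0 ∅
    set ν := rcMeasureW (delW p {e | ∃ v ∈ e, ∃ x ∈ X, (openGraph ω).Reachable x v}) q ∅ with hν
    set a : ℝ := (rcMeasureW p q ∅).real
      {ω' : BondConfig V | ∀ x ∈ insert s X, ¬ (openGraph ω').Reachable y x} with ha'
    set b : ℝ := (rcMeasureW p q ∅).real
      ({ω' : BondConfig V | ∀ x ∈ insert s X, ¬ (openGraph ω').Reachable y x} ∩ openConn y z) with hb'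
    have ha0 : 0 ≤ a := measureReal_nonneg
    set IZ := ∫ η in (openConn s z : Set (BondConfig V)), g (openEdgeCluster η s) ∂ν with hIZ
    set IY := ∫ η in (openConn s y : Set (BondConfig V)), g (openEdgeCluster η s) ∂ν with hIY
    set I1 := ∫ η, g (openEdgeCluster η s) ∂ν with hI1
    set mZ := ν.real (openConn s z : Set (BondConfig V)) with hmZ
    set mY := ν.real (openConn s y : Set (BondConfig V)) with hmY
    set mN := ν.real (openConn s y : Set (BondConfig V))ᶜ with hmN
    set mNW := ν.real ((openConn s y : Set (BondConfig V))ᶜ ∩ openConn y z) with hmNW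
    -- MDL(∅) in the world: (K6) for `φ_{𝐩,q}` at `S = {s}`
    have mdl := covTransfer_relaySet_edge_rc (delW p {e | ∃ v ∈ e, ∃ x ∈ X, (openGraph ω).Reachable x v}) hq
      ({s} : Finset V) z y s (Finset.mem_singleton_self s) g hg
    have h1 : {ω' : BondConfig V | ∀ t ∈ ({s} : Finset V), ¬ (openGraph ω').Reachable y t} =
        (openConn s y : Set (BondConfig V))ᶜ := by
      ext ω'
      simp only [Finset.mem_singleton, forall_eq, mem_setOf_eq, mem_compl_iff, openConn]
      exact ⟨fun h h' => h h'.symm, fun h h' => h h'.symm⟩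
    have h2 : (⋃ t ∈ ({s} : Finset V), (openConn y t : Set (BondConfig V))) = openConn s y := by
      rw [Finset.set_biUnion_singleton, openConn_symm]
    have h3 : (⋃ t ∈ ({s} : Finset V), (openConn z t : Set (BondConfig V))) = openConn s z := by
      rw [Finset.set_biUnion_singleton, openConn_symm]
    have h4 : (openConn z y : Set (BondConfig V)) = openConn y z := openConn_symm z y
    rw [h1, h2, h3, h4] at mdl
    change mNW * (IY - mY * I1) ≤ mN * (IZ - mZ * I1) at mdl
    -- FKG in the world
    have harris : mZ * I1 ≤ IZ :=
      setIntegral_edgeFun_ge_rc _ hq s g hg (openConn s z) (isUpperSet_openConn s z)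
    -- the pointwise inequality `T_A`-integrand ≤ two-marker integrand
    have hcovZ : 0 ≤ IZ - I1 * mZ := by linarith
    have key : mNW / mN * (IY - I1 * mY) ≤ IZ - I1 * mZ := by
      by_cases hN : mN = 0
      · rw [hN, div_zero, zero_mul]; exact hcovZ
      · have hpos : 0 < mN := lt_of_le_of_ne measureReal_nonneg (Ne.symm hN)
        rw [div_mul_eq_mul_div, div_le_iff₀ hpos]
        linarith
    have hfinal : 0 ≤ a * ((IZ - I1 * mZ) - mNW / mN * (IY - I1 * mY)) :=
      mul_nonneg ha0 (sub_nonneg.2 key)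
    have hid : a * (IZ - I1 * mZ) - b * (IY - I1 * mY) - (a * (mNW / mN) - b) * (IY - I1 * mY) =
        a * ((IZ - I1 * mZ) - mNW / mN * (IY - I1 * mY)) := by ring
    linarith [hfinal, hid]
  -- the reduction theorem (two-marker form, closure over degenerate parameters)
  exact BHK2006_twoMarkerCov_le_of_within_rc_of_forall_nondegenerate w hq s X y z
    (fun p => (rcMeasureW p q ∅).real {ω' : BondConfig V | ∀ x ∈ insert s X, ¬ (openGraph ω').Reachable y x})
    (fun p => (rcMeasureW p q ∅).real
      ({ω' : BondConfig V | ∀ x ∈ insert s X, ¬ (openGraph ω').Reachable y x} ∩ openConn y z))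
    ha hb hR F hF

/-- **The measure form of `T_A` is `FK.taQ / Z²`** (sum level ↔ measure level, any `q > 0`): the `hTA` integral of
`FK.markerDominanceAvoid_of_TA_rc` at parameters `p` equals `FK.taQ p q s y z X g / (rcPartitionFunctionW p q ∅)^2`
(`FK.taQ = A·b − a·B` with the unnormalised random-cluster weights; the worlds `rcMeasureW (delW p (cut X ω)) q ∅` are the
`FK.wE` expectations).  The `q = 1` statement is `HullPort.TA_integral_eq_taQ`.
[cite: Grimmett2006, §1.4 eq. (1.20) (p. 15)] [cite: VandenbergHaggstromKahn2005, §2.1 eq. (11) (p. 9), Lemma 2.3 (p. 10)] -/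
theorem TA_integral_eq_taQ_rc (p : Sym2 V → unitInterval) {q : ℝ} (hq : 0 < q) (s y z : V) (X : Set V)
    (g : Set (Sym2 V) → ℝ) :
    ∫ ω in {ω : BondConfig V | ∀ x ∈ X, ¬ (openGraph ω).Reachable s x},
        ((rcMeasureW p q ∅).real {ω' : BondConfig V | ∀ x ∈ insert s X, ¬ (openGraph ω').Reachable y x} *
              ((rcMeasureW (delW p {e | ∃ v ∈ e, ∃ x ∈ X, (openGraph ω).Reachable x v}) q ∅).real
                  ((openConn s y : Set (BondConfig V))ᶜ ∩ openConn y z) /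
                (rcMeasureW (delW p {e | ∃ v ∈ e, ∃ x ∈ X, (openGraph ω).Reachable x v}) q ∅).real
                  (openConn s y : Set (BondConfig V))ᶜ) -
            (rcMeasureW p q ∅).real ({ω' : BondConfig V | ∀ x ∈ insert s X, ¬ (openGraph ω').Reachable y x} ∩
              openConn y z)) *
          ((∫ η in (openConn s y : Set (BondConfig V)), g (openEdgeCluster η s)
                ∂(rcMeasureW (delW p {e | ∃ v ∈ e, ∃ x ∈ X, (openGraph ω).Reachable x v}) q ∅)) -
            (∫ η, g (openEdgeCluster η s)
                ∂(rcMeasureW (delW p {e | ∃ v ∈ e, ∃ x ∈ X, (openGraph ω).Reachable x v}) q ∅)) *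
              (rcMeasureW (delW p {e | ∃ v ∈ e, ∃ x ∈ X, (openGraph ω).Reachable x v}) q ∅).real
                (openConn s y : Set (BondConfig V)))
        ∂(rcMeasureW p q ∅) =
      taQ p q s y z X g / (rcPartitionFunctionW p q ∅) ^ 2 := by
  classical
  set Z : ℝ := rcPartitionFunctionW p q ∅ with hZ
  have hZpos : 0 < Z := rcPartitionFunctionW_pos p hq ∅
  have hZne : Z ≠ 0 := hZpos.ne'
  -- outer events as unnormalised sums
  have hAy : (rcMeasureW p q ∅).real {ω' : BondConfig V | ∀ x ∈ insert s X, ¬ (openGraph ω').Reachable y x} =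
      tab p q s y X / Z := by
    rw [rcMeasureW_real_eq_sum_div p hq ∅]; rfl
  have hAW : (rcMeasureW p q ∅).real ({ω' : BondConfig V | ∀ x ∈ insert s X, ¬ (openGraph ω').Reachable y x} ∩
      openConn y z) = taa p q s y z X / Z := by
    rw [rcMeasureW_real_eq_sum_div p hq ∅]; rfl
  -- world quantities as `FK.wE` expectations
  have hwr : ∀ (ω : BondConfig V) (E : Set (BondConfig V)),
      (rcMeasureW (delW p {e | ∃ v ∈ e, ∃ x ∈ X, (openGraph ω).Reachable x v}) q ∅).real E =
        wE p q (cut X ω) (ind E) := by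
    intro ω E; rw [rcMeasureW_real_eq_sum_rcMass _ hq]; rfl
  have hwi1 : ∀ ω : BondConfig V,
      ∫ η in (openConn s y : Set (BondConfig V)), g (openEdgeCluster η s)
          ∂(rcMeasureW (delW p {e | ∃ v ∈ e, ∃ x ∈ X, (openGraph ω).Reachable x v}) q ∅) =
        wE p q (cut X ω) (fun ζ => g (openEdgeCluster ζ s) * ind (openConn s y) ζ) := by
    intro ω; rw [setIntegral_rcMeasureW_eq_sum _ hq]; rfl
  have hwi2 : ∀ ω : BondConfig V,
      ∫ η, g (openEdgeCluster η s) ∂(rcMeasureW (delW p {e | ∃ v ∈ e, ∃ x ∈ X, (openGraph ω).Reachable x v}) q ∅) =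
        wE p q (cut X ω) (fun ζ => g (openEdgeCluster ζ s)) := by
    intro ω; rw [integral_rcMeasureW_eq_sum _ hq]; rfl
  rw [setIntegral_rcMeasureW_eq_sum p hq]
  simp only [hAy, hAW, hwr, hwi1, hwi2]
  have hD : ∀ ω : BondConfig V, ind {ω : BondConfig V | ∀ x ∈ X, ¬ (openGraph ω).Reachable s x} ω =
      ind (avoidEv s X) ω := fun ω => rfl
  have hmass : ∀ ω : BondConfig V, rcMass p q ω = rcWeightW p q ∅ ω / Z := fun ω => rfl
  simp only [hD, hmass]
  have hterm : ∀ ω : BondConfig V,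
      rcWeightW p q ∅ ω / Z *
        ((tab p q s y X / Z *
              (wE p q (cut X ω) (ind ((openConn s y : Set (BondConfig V))ᶜ ∩ openConn y z)) /
                wE p q (cut X ω) (ind (openConn s y : Set (BondConfig V))ᶜ)) -
            taa p q s y z X / Z) *
          (wE p q (cut X ω) (fun ζ => g (openEdgeCluster ζ s) * ind (openConn s y) ζ) -
            wE p q (cut X ω) (fun ζ => g (openEdgeCluster ζ s)) * wE p q (cut X ω) (ind (openConn s y))) *
          ind (avoidEv s X) ω) =
      (1 / Z ^ 2) * (tab p q s y X * (rcWeightW p q ∅ ω *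
          (ind (avoidEv s X) ω * (taNW p q s y z X ω / taN p q s y X ω * taC p q s y X g ω))) -
        taa p q s y z X * (rcWeightW p q ∅ ω * (ind (avoidEv s X) ω * taC p q s y X g ω))) := by
    intro ω
    simp only [taC, taN, taNW]
    field_simp
  simp only [hterm, Finset.sum_sub_distrib, ← Finset.mul_sum]
  simp only [taQ, taA, taB]
  field_simp

/-- **MDL(X) for `φ_{𝐩,q}`, `q ≥ 1`, from `0 ≤ FK.taQ` at all non-degenerate parameters** (the sum form in which fk-2's
`FK.taQ_nonneg_of_Pv` concludes). [cite: VandenbergHaggstromKahn2005, Thm. 2.1 (p. 9), §2.1 pp. 10–13 — corollary, derived in the cell]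
[cite: Grimmett2006, Thm. (3.8)(b); §1.4 eq. (1.20)] -/
theorem markerDominanceAvoid_of_taQ {q : ℝ} (hq : 1 ≤ q) (w : Sym2 V → unitInterval) (s y z : V) (X : Set V)
    (hTAQ : ∀ p : Sym2 V → unitInterval, (∀ e, 0 < p e ∧ p e < 1) →
      ∀ g : Set (Sym2 V) → ℝ, Monotone g → (∀ C, 0 ≤ g C) → 0 ≤ taQ p q s y z X g)
    (F : Set (Sym2 V) → ℝ) (hF : Monotone F) :
    (rcMeasureW w q ∅).real ({ω : BondConfig V | ∀ x ∈ insert s X, ¬ (openGraph ω).Reachable y x} ∩ openConn y z) *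
        ((rcMeasureW w q ∅).real {ω : BondConfig V | ∀ x ∈ X, ¬ (openGraph ω).Reachable s x} *
            (∫ ω in {ω : BondConfig V | ∀ x ∈ X, ¬ (openGraph ω).Reachable s x} ∩ openConn s y,
              F (openEdgeCluster ω s) ∂(rcMeasureW w q ∅)) -
          (∫ ω in {ω : BondConfig V | ∀ x ∈ X, ¬ (openGraph ω).Reachable s x},
              F (openEdgeCluster ω s) ∂(rcMeasureW w q ∅)) *
            (rcMeasureW w q ∅).real ({ω : BondConfig V | ∀ x ∈ X, ¬ (openGraph ω).Reachable s x} ∩ openConn s y)) ≤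
      (rcMeasureW w q ∅).real {ω : BondConfig V | ∀ x ∈ insert s X, ¬ (openGraph ω).Reachable y x} *
        ((rcMeasureW w q ∅).real {ω : BondConfig V | ∀ x ∈ X, ¬ (openGraph ω).Reachable s x} *
            (∫ ω in {ω : BondConfig V | ∀ x ∈ X, ¬ (openGraph ω).Reachable s x} ∩ openConn s z,
              F (openEdgeCluster ω s) ∂(rcMeasureW w q ∅)) -
          (∫ ω in {ω : BondConfig V | ∀ x ∈ X, ¬ (openGraph ω).Reachable s x},
              F (openEdgeCluster ω s) ∂(rcMeasureW w q ∅)) *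
            (rcMeasureW w q ∅).real ({ω : BondConfig V | ∀ x ∈ X, ¬ (openGraph ω).Reachable s x} ∩ openConn s z)) := by
  have hq0 : 0 < q := one_pos.trans_le hq
  refine markerDominanceAvoid_of_TA_rc hq w s y z X (fun p hp g hg hg0 => ?_) F hF
  rw [TA_integral_eq_taQ_rc p hq0 s y z X g]
  exact div_nonneg (hTAQ p hp g hg hg0) (sq_nonneg _)

/-- **MDL(X) for `φ_{𝐩,q}`, `q ≥ 1`, from prim-hp-7's Lemma `P_v` for `φ_{𝐩,q}`** (functional marker dominance lemma with
an avoided set, for the random-cluster measure and every parameter vector `w`), the hypothesis `hPv` being EXACTLY that of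
fk-2's `FK.taQ_nonneg_of_Pv` (sum form, every parameter vector `u`, every vertex `v'`), for every monotone `g ≥ 0`.
Chain: `hPv` ⟹ `0 ≤ FK.taQ` at non-degenerate parameters (`FK.taQ_nonneg_of_Pv`; its invariant `hINV` — weight-`1` pairs
lie inside `X` — is vacuous there) ⟹ MDL(X) (`FK.markerDominanceAvoid_of_taQ`).  The `q = 1` statement is
`HullPort.markerDominanceAvoid_of_Pv`. [cite: VandenbergHaggstromKahn2005, Thm. 2.1 (p. 9), §2.1 pp. 10–13 — corollary, derived in the cell]
[cite: Grimmett2006, Thm. (3.8)(b); §1.4 eq. (1.20)] -/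
theorem markerDominanceAvoid_of_Pv_rc {q : ℝ} (hq : 1 ≤ q) (w : Sym2 V → unitInterval) (s y z : V) (X : Set V)
    (hsy : s ≠ y)
    (hPv : ∀ g : Set (Sym2 V) → ℝ, Monotone g → (∀ C, 0 ≤ g C) →
      ∀ (u : Sym2 V → unitInterval) (v' : V),
      taB u q s y {v'} g ≤ rcPartitionFunctionW u q ∅ *
        ((1 - wE u q ∅ (ind ((openConn s y : Set (BondConfig V))ᶜ ∩ openConn y v')) /
              wE u q ∅ (ind (openConn s y : Set (BondConfig V))ᶜ)) *
          (wE u q ∅ (fun η => g (openEdgeCluster η s) * ind (openConn s y) η) -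
            wE u q ∅ (fun η => g (openEdgeCluster η s)) * wE u q ∅ (ind (openConn s y)))))
    (F : Set (Sym2 V) → ℝ) (hF : Monotone F) :
    (rcMeasureW w q ∅).real ({ω : BondConfig V | ∀ x ∈ insert s X, ¬ (openGraph ω).Reachable y x} ∩ openConn y z) *
        ((rcMeasureW w q ∅).real {ω : BondConfig V | ∀ x ∈ X, ¬ (openGraph ω).Reachable s x} *
            (∫ ω in {ω : BondConfig V | ∀ x ∈ X, ¬ (openGraph ω).Reachable s x} ∩ openConn s y,
              F (openEdgeCluster ω s) ∂(rcMeasureW w q ∅)) -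
          (∫ ω in {ω : BondConfig V | ∀ x ∈ X, ¬ (openGraph ω).Reachable s x},
              F (openEdgeCluster ω s) ∂(rcMeasureW w q ∅)) *
            (rcMeasureW w q ∅).real ({ω : BondConfig V | ∀ x ∈ X, ¬ (openGraph ω).Reachable s x} ∩ openConn s y)) ≤
      (rcMeasureW w q ∅).real {ω : BondConfig V | ∀ x ∈ insert s X, ¬ (openGraph ω).Reachable y x} *
        ((rcMeasureW w q ∅).real {ω : BondConfig V | ∀ x ∈ X, ¬ (openGraph ω).Reachable s x} *
            (∫ ω in {ω : BondConfig V | ∀ x ∈ X, ¬ (openGraph ω).Reachable s x} ∩ openConn s z,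
              F (openEdgeCluster ω s) ∂(rcMeasureW w q ∅)) -
          (∫ ω in {ω : BondConfig V | ∀ x ∈ X, ¬ (openGraph ω).Reachable s x},
              F (openEdgeCluster ω s) ∂(rcMeasureW w q ∅)) *
            (rcMeasureW w q ∅).real ({ω : BondConfig V | ∀ x ∈ X, ¬ (openGraph ω).Reachable s x} ∩ openConn s z)) := by
  refine markerDominanceAvoid_of_taQ hq w s y z X (fun p hp g hg hg0 => ?_) F hF
  have hINV : ∀ e : Sym2 V, ((p e : unitInterval) : ℝ) = 1 → ∀ u ∈ e, u ∈ X := by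
    intro e he
    have h1 : ((p e : unitInterval) : ℝ) < 1 := by
      have := (hp e).2
      exact_mod_cast this
    exact absurd he h1.ne
  exact taQ_nonneg_of_Pv hq s y hsy g hg (hPv g hg hg0) p X hINV z

end Summit.CriticalPhenomena.PercolationContinuityZ3.Theorems.FK

end
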